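import Summits.CriticalPhenomena.PercolationContinuityZ3.Theorems.PercNearOneGluingNoHeavyLowerTailSunflowerGoodCoordinate
import Summits.CriticalPhenomena.PercolationContinuityZ3.Theorems.PercNearOneGluingNoHeavyLowerTailSunflowerTwoPointCompleting
import HarnessLib

/-!
# `NoHeavyLowerTail` (crux stmt-CriticalPhenomena-4575), abstract sunflower cubic: the PENDANT and ISOLATED reductions for ★

Support file (seat `prim-ineq-gen-2` gen 25; `--supports stmt-CriticalPhenomena-4575`).  No `sorry`; nothing is asserted about the crux.
Memo: run/shared/lean/prim/prim-ineq-gen-2/TWO-POINT-GEN25.md §6/§9 — the degree-0/1 cases of the structured-window induction for ★ on graph-mark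
sunflowers, packaged as direct corollaries of the tree's (H*) mechanism `Sunflower.ZP_insert_ge_of_no_sameDir` (no two blocks with same-direction
petal transitions): if `v` changes the labels of at most the sets containing one fixed point `u` (a PENDANT vertex whose only generator is the edge
`v u`, of any colour; or an ISOLATED vertex, `u` arbitrary), then two disjoint blocks never both move, so (H*) holds and
`2·F.ZP W' + (F.con v).ZP W' ≤ F.ZP (insert v W')` (`ZP_insert_ge_of_pendant`; for an isolated vertex in fact `F.ZP (insert v W') = 3·F.ZP W'`,
`ZP_insert_eq_of_isolated`).
-/

namespace Summit.CriticalPhenomena.PercolationContinuityZ3.Theorems.SunflowerPartition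

open Finset

variable {α : Type*} [Fintype α] [DecidableEq α]

omit [Fintype α] in
/-- Pointwise-equal kernels on the partitions of `W` have equal nested sums. [this work] -/
theorem nested_congr (W : Finset α) (G H : Finset α → Finset α → Finset α → ℤ)
    (h : ∀ X ⊆ W, ∀ S ⊆ W \ X, G X S ((W \ X) \ S) = H X S ((W \ X) \ S)) : nested W G = nested W H := by
  unfold nested
  exact sum_congr rfl fun X hX => sum_congr rfl fun S hS => h X (mem_powerset.1 hX) S (mem_powerset.1 hS)

namespace Sunflower

variable (F : Sunflower α)

/-- **Pendant reduction**: if on the sub-cube `2^W'` the point `v ∉ W'` changes only the labels of sets containing `u`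
(`lab (X+v) = lab X` whenever `u ∉ X ⊆ W'`), then `2·F.ZP W' + (F.con v).ZP W' ≤ F.ZP (insert v W')`. [this work] -/
theorem ZP_insert_ge_of_pendant (W' : Finset α) (v u : α) (hv : v ∉ W')
    (h : ∀ X ⊆ W', u ∉ X → F.lab (insert v X) = F.lab X) :
    2 * F.ZP W' ∅ ∅ ∅ + (F.con v).ZP W' ∅ ∅ ∅ ≤ F.ZP (insert v W') ∅ ∅ ∅ := by
  rw [F.con_ZP_eq]
  refine F.ZP_insert_ge_of_no_sameDir W' v hv fun X hX S hS => ?_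
  have hXW : X ⊆ W' := mem_powerset.1 hX
  have hSW : S ⊆ W' \ X := mem_powerset.1 hS
  -- at most one of the disjoint blocks `X`, `S` contains `u`; the other one does not move
  by_cases huX : u ∈ X
  · have huS : u ∉ S := fun hu => (mem_sdiff.1 (hSW hu)).2 huX
    have eS := h S (hSW.trans sdiff_subset) huS
    rw [eS]
    rintro (⟨-, -, hS1, hS2⟩ | ⟨-, -, hS1, hS2⟩)
    · exact hS1.2 hS2
    · exact hS2.1 hS1
  · have eX := h X hXW huX
    rw [eX]
    rintro (⟨hX1, hX2, -, -⟩ | ⟨hX1, hX2, -, -⟩)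
    · exact hX1.2 hX2
    · exact hX2.1 hX1

/-- **Isolated reduction** (exact): if `v ∉ W'` changes no label on `2^W'`, then `F.ZP (insert v W') = 3·F.ZP W'` and
`(F.con v).ZP W' = F.ZP W'`. [this work] -/
theorem ZP_insert_eq_of_isolated (W' : Finset α) (v : α) (hv : v ∉ W') (h : ∀ X ⊆ W', F.lab (insert v X) = F.lab X) :
    F.ZP (insert v W') ∅ ∅ ∅ = 3 * F.ZP W' ∅ ∅ ∅ ∧ (F.con v).ZP W' ∅ ∅ ∅ = F.ZP W' ∅ ∅ ∅ := by
  have hcon : (F.con v).ZP W' ∅ ∅ ∅ = F.ZP W' ∅ ∅ ∅ := by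
    rw [(F.con v).ZP_empty_eq_nested, F.ZP_empty_eq_nested]
    refine nested_congr W' _ _ fun X hX S hS => ?_
    have hT : (W' \ X) \ S ⊆ W' := sdiff_subset.trans sdiff_subset
    rw [F.lab_con, F.lab_con, F.lab_con, h X hX, h S (hS.trans sdiff_subset), h _ hT]
  refine ⟨?_, hcon⟩
  rw [F.ZP_empty_eq_nested, F.ZP_empty_eq_nested, nested_insert_split _ v hv]
  have e1 : nested W' (fun X S T => s6H (F.lab (insert v X)) (F.lab S) (F.lab T)) = nested W' (fun X S T => s6H (F.lab X) (F.lab S) (F.lab T)) :=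
    nested_congr W' _ _ fun X hX S _ => by rw [h X hX]
  have e2 : nested W' (fun X S T => s6H (F.lab X) (F.lab (insert v S)) (F.lab T)) = nested W' (fun X S T => s6H (F.lab X) (F.lab S) (F.lab T)) :=
    nested_congr W' _ _ fun X _ S hS => by rw [h S (hS.trans sdiff_subset)]
  have e3 : nested W' (fun X S T => s6H (F.lab X) (F.lab S) (F.lab (insert v T))) = nested W' (fun X S T => s6H (F.lab X) (F.lab S) (F.lab T)) :=
    nested_congr W' _ _ fun X _ S _ => by rw [h _ (sdiff_subset.trans sdiff_subset)]
  rw [e1, e2, e3]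
  ring

end Sunflower

end Summit.CriticalPhenomena.PercolationContinuityZ3.Theorems.SunflowerPartition
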